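import Literature.NumberTheory.IwasawaTheory.ImaginaryQuadraticTwoTowerLambdaOfRootsOfUnity
import Mathlib.NumberTheory.NumberField.Cyclotomic.Ideal
import HarnessLib

/-!
# No new roots of unity in the cyclotomic `ℤ₂`-tower of `ℚ(√−d)`, `d ≡ 3 (mod 4)`, and the Ferrero–Kida `λ₂`-formula for these fields, UNCONDITIONALLY
# (hypothesis (W) of `ImaginaryQuadraticTwoTowerLambdaOfRootsOfUnity` discharged; proved; no definition, no named fact)

Topic `NumberTheory/IwasawaTheory` (namespace = path).  THEOREM-ONLY file, written by the prover seat `bsd-line-att-p3` g31 (cell `bsd-f1-sign2`; `--supports`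
stmt-BirchSwinnertonDyer-22298; closes nothing).

(W) for `X = e(K)·ℚ_m ⊆ ℚ̄` (`K ∋ η`, `η² = −d`, `d ≡ 3 (mod 4)` squarefree): EVERY ROOT OF UNITY OF `X` LIES IN `e(K)`.  §1 `dvd_discr_of_sq_eq` (valuation lemma:
an algebraic integer `t` with `t² = N`, `ℓ ∥ N`, forces `ℓ ∣ d_F`: `2·ord_𝔮(t) = e(𝔮∣ℓ) = 1` is impossible); §2 `complexConj_eq_neg_of_sq_eq_neg` (`z² = −c < 0 ⟹ z̄ = −z`);
§3 `totient_le_two_of_isPrimitiveRoot` (a primitive `p^{k+1}`-th root of unity, `p` odd, in a CM field with `X⁺` unramified at `p` forces `p^k(p−1) ≤ e(𝔓∣X⁺)·e(X⁺∣p) ≤ 2`,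
Mathlib `IsCyclotomicExtension.Rat.ramificationIdx_eq_of_prime_pow`); §4 ★ `rootsOfUnity_mem_fieldRange` = (W) (odd part of the order divides `3`; `i ∈ X` would put
`√d = iη ∈ X⁺`, a primitive cube root `ζ` with `d ≠ 3` would put `√(3d) = (2ζ+1)η ∈ X⁺`, both excluded by §1 at an odd `ℓ ∥ d`, `ℓ ∥ 3d` since `X⁺ ≅ ℚ_m` is unramified
at odd primes; `±1, ±ζ₃^{±1} ∈ e(K)`); §5 ★★ `ferreroKida_of_sq_eq_neg`: **`[K : ℚ] = 2`, `K ∋ η`, `η² = −d`, `d ≡ 3 (mod 4)` squarefree ⟹ for EVERY cyclotomic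
`ℤ₂`-extension `κ` of `K`: `ClassicalMuVanishes κ ∧ classicalLambda κ + 1 = Σ_{p ∈ primeFactors d ∖ {2}} 2^{v₂(p²−1)−3}`** — the named fact
`ferreroKida_classicalLambda_two_imaginaryQuadratic` (Ferrero 1980 / Kida 1979) PROVED on its `d ≡ 3 (mod 4)` half (for `d ≢ 3 (mod 4)` the prime `2` ramifies
in `K`, capitulation occurs, and the half is not treated here).

References: [Ferrero1980AJM] Thm.; [Kida1979Tohoku] Thm. 1; [Schettler2014] Thm. 2; [Washington1997] §13.1, Prop. 13.26–13.28; [NeukirchANT1999] Ch. I §8–§9.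
-/

set_option autoImplicit false

noncomputable section

open scoped NumberField nonZeroDivisors
open NumberField NumberField.IsCMField IsDedekindDomain Field IntermediateField Module Ideal Finset

namespace Literature.NumberTheory.IwasawaTheory

open Literature.NumberTheory.EllipticCurves Literature.NumberTheory.EllipticCurves.ZpExtension
  Literature.NumberTheory.GaloisRepresentations Literature.NumberTheory.NumberFields

/-! ## §1 The valuation lemma: `t² = N`, `ℓ ∥ N` ⟹ `ℓ` ramifies -/

section Valuation

/-- **`t² = N` with `ℓ ∥ N` forces `ℓ ∣ d_F`.**  If a number field `F` contains an algebraic integer `t` with `t² = N` (`N ∈ ℕ`), and the prime `ℓ` divides `N`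
exactly once, then `ℓ` divides the discriminant of `F` (is ramified): otherwise at a prime `𝔮` of `F` above `ℓ` the multiplicity of `𝔮` in `(N) = (ℓ)·(N/ℓ)` is
`e(𝔮∣ℓ) + 0 = 1`, but in `(t)²` it is even. [cite: NeukirchANT1999, Ch. I §8 Prop. (8.2) and Ch. III §2 Thm. (2.6)] -/
theorem dvd_discr_of_sq_eq (F : Type) [Field F] [NumberField F] (t : 𝓞 F) {N ℓ : ℕ} (hℓ : ℓ.Prime) (ht : t ^ 2 = (N : 𝓞 F))
    (hℓN : ℓ ∣ N) (hℓ2N : ¬ ℓ ^ 2 ∣ N) : (ℓ : ℤ) ∣ NumberField.discr F := by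
  classical
  by_contra hnd
  have hℓ' : Prime (ℓ : ℤ) := Nat.prime_iff_prime_int.mp hℓ
  haveI : Fact ℓ.Prime := ⟨hℓ⟩
  haveI hmax : (Ideal.span {(ℓ : ℤ)}).IsMaximal := Int.ideal_span_isMaximal_of_prime ℓ
  have hunr := (NumberField.not_dvd_discr_iff_isUnramifiedIn F (𝓞 F) hℓ').mp hnd
  have hℓ0 : Ideal.span {(ℓ : ℤ)} ≠ ⊥ := by
    rw [Ne, Ideal.span_singleton_eq_bot]; exact_mod_cast hℓ.ne_zero
  obtain ⟨Q, hQmax, hQ⟩ := Ideal.exists_maximal_ideal_liesOver_of_isIntegral (S := 𝓞 F) (Ideal.span {(ℓ : ℤ)})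
  haveI := hQ
  haveI := hQmax
  have hQprime : Prime Q := Ideal.prime_of_isPrime (Ideal.ne_bot_of_liesOver_of_ne_bot hℓ0 Q) hQmax.isPrime
  have he : Q.ramificationIdx ℤ = 1 := (Algebra.isUnramifiedIn_iff_forall_ramificationIdx_eq_one.mp hunr) Q hQ
  have hmap : (Ideal.span {(ℓ : ℤ)}).map (algebraMap ℤ (𝓞 F)) = Ideal.span {((ℓ : ℕ) : 𝓞 F)} := by
    rw [Ideal.map_span, Set.image_singleton, map_natCast]
  have hmap0 : (Ideal.span {(ℓ : ℤ)}).map (algebraMap ℤ (𝓞 F)) ≠ ⊥ := by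
    rw [hmap, Ne, Ideal.span_singleton_eq_bot]; exact_mod_cast hℓ.ne_zero
  have hmult : emultiplicity Q (Ideal.span {((ℓ : ℕ) : 𝓞 F)}) = 1 := by
    rw [← hmap]
    have hfin : FiniteMultiplicity Q ((Ideal.span {(ℓ : ℤ)}).map (algebraMap ℤ (𝓞 F))) :=
      FiniteMultiplicity.of_prime_left hQprime hmap0
    rw [hfin.emultiplicity_eq_multiplicity, ← Ideal.IsDedekindDomain.ramificationIdx_eq_multiplicity (Ideal.span {(ℓ : ℤ)}) Q hmap0, he]
    rfl
  obtain ⟨N', hN'⟩ := hℓN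
  have hℓN' : ¬ ℓ ∣ N' := fun h => hℓ2N (by rw [hN', pow_two]; exact Nat.mul_dvd_mul_left ℓ h)
  have hQN' : emultiplicity Q (Ideal.span {((N' : ℕ) : 𝓞 F)}) = 0 := by
    rw [emultiplicity_eq_zero, Ideal.dvd_span_singleton]
    intro hmem
    apply hℓN'
    have h1 : ((N' : ℤ) : 𝓞 F) ∈ Q := by exact_mod_cast hmem
    have h2 : (N' : ℤ) ∈ Q.under ℤ := by
      rw [Ideal.under_def, Ideal.mem_comap]; simpa using h1
    rw [← hQ.over, Ideal.mem_span_singleton] at h2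
    exact_mod_cast Int.natAbs_dvd_natAbs.mpr h2
  have hideal : (Ideal.span {t}) ^ 2 = Ideal.span {((ℓ : ℕ) : 𝓞 F)} * Ideal.span {((N' : ℕ) : 𝓞 F)} := by
    rw [Ideal.span_singleton_pow, Ideal.span_singleton_mul_span_singleton, ht, hN', Nat.cast_mul]
  have h1 : emultiplicity Q ((Ideal.span {t}) ^ 2) = 2 * emultiplicity Q (Ideal.span {t}) := emultiplicity_pow hQprime
  have h2 : emultiplicity Q (Ideal.span {((ℓ : ℕ) : 𝓞 F)} * Ideal.span {((N' : ℕ) : 𝓞 F)}) = 1 := by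
    rw [emultiplicity_mul hQprime, hmult, hQN', add_zero]
  rw [hideal, h2] at h1
  have ht0 : Ideal.span {t} ≠ ⊥ := by
    rw [Ne, Ideal.span_singleton_eq_bot]
    rintro rfl
    have hN0 : (N : 𝓞 F) = 0 := by rw [← ht]; ring
    have : N = 0 := by exact_mod_cast hN0
    apply hℓ2N; rw [this]; exact dvd_zero _
  have hfin : FiniteMultiplicity Q (Ideal.span {t}) := FiniteMultiplicity.of_prime_left hQprime ht0
  rw [hfin.emultiplicity_eq_multiplicity] at h1
  have h3 : ((1 : ℕ) : ℕ∞) = ((2 * multiplicity Q (Ideal.span {t}) : ℕ) : ℕ∞) := by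
    rw [Nat.cast_mul]; exact_mod_cast h1
  have h4 := ENat.coe_inj.mp h3
  omega

end Valuation

/-! ## §2 Purely imaginary square roots in a CM field -/

section Conj

variable (X : Type) [Field X] [NumberField X] [IsCMField X]

/-- **`z² = −c` with `c > 0` rational forces `z̄ = −z`** in a CM field: `z̄ = ±z` (both are roots of `T² + c`), and `z̄ = z` would make `z` real with a negative
square. [cite: Washington1997, §4 (before Thm. 4.12)] -/
theorem complexConj_eq_neg_of_sq_eq_neg {z : X} {c : ℚ} (hc : 0 < c) (hz : z ^ 2 = -((c : ℚ) : X)) : complexConj X z = -z := by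
  have h2 : (complexConj X z) ^ 2 = -((c : ℚ) : X) := by rw [← map_pow, hz, map_neg, map_ratCast]
  have hprod : (complexConj X z - z) * (complexConj X z + z) = 0 := by linear_combination h2 - hz
  rcases mul_eq_zero.mp hprod with h | h
  · exfalso
    have hzr : z ∈ maximalRealSubfield X := (complexConj_eq_self_iff X z).mp (sub_eq_zero.mp h)
    rw [mem_maximalRealSubfield_iff] at hzr
    let φ : X →+* ℂ := Classical.choice (inferInstance : Nonempty (X →+* ℂ))
    obtain ⟨r, hr⟩ := Complex.conj_eq_iff_real.mp (hzr φ)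
    have h3 : (φ z) ^ 2 = -((c : ℚ) : ℂ) := by rw [← map_pow, hz, map_neg, map_ratCast]
    rw [hr] at h3
    have h4 : (r : ℂ) ^ 2 = ((-(c : ℝ) : ℝ) : ℂ) := by rw [h3]; push_cast; rfl
    have h5 : r ^ 2 = -(c : ℝ) := by exact_mod_cast h4
    have h6 : (0 : ℝ) < c := by exact_mod_cast hc
    nlinarith [sq_nonneg r]
  · linear_combination h

end Conj

/-! ## §3 Ramification bound: a primitive `p^{k+1}`-th root of unity forces `p^k (p − 1) ≤ 2` -/

section Ram

variable (X : Type) [Field X] [NumberField X] [IsCMField X]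

/-- **`φ(p^{k+1}) ≤ 2` for a primitive `p^{k+1}`-th root of unity (`p` odd) in a CM field `X` whose maximal real subfield is unramified at `p`**:
`e_p(ℚ(ζ)) = p^k(p−1)` divides `e(𝔓 ∣ p) = e(𝔓 ∣ X⁺)·e(X⁺ ∣ p) ≤ 2·1` for a prime `𝔓` of `X` above `p`. [cite: Washington1997, Prop. 2.3 and Lemma 2.12 (ramification in
cyclotomic fields)] [cite: NeukirchANT1999, Ch. I §9 Prop. (9.6)] -/
theorem totient_le_two_of_isPrimitiveRoot (hdisc : ∀ ℓ : ℕ, ℓ.Prime → ℓ ≠ 2 → ¬ (ℓ : ℤ) ∣ NumberField.discr ↥(maximalRealSubfield X))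
    {p k : ℕ} (hp : p.Prime) (hp2 : p ≠ 2) {ζ : X} (hζ : IsPrimitiveRoot ζ (p ^ (k + 1))) : p ^ k * (p - 1) ≤ 2 := by
  classical
  haveI : Fact p.Prime := ⟨hp⟩
  haveI : NeZero (p ^ (k + 1)) := ⟨pow_ne_zero _ hp.ne_zero⟩
  have hp' : Prime (p : ℤ) := Nat.prime_iff_prime_int.mp hp
  haveI hmax : (Ideal.span {(p : ℤ)}).IsMaximal := Int.ideal_span_isMaximal_of_prime p
  set F : IntermediateField ℚ X := ℚ⟮ζ⟯ with hF
  haveI : IsCyclotomicExtension {p ^ (k + 1)} ℚ ↥F := hζ.intermediateField_adjoin_isCyclotomicExtension (K := ℚ)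
  haveI : NumberField ↥F := { to_charZero := inferInstance, to_finiteDimensional := inferInstance }
  have hp0 : Ideal.span {(p : ℤ)} ≠ ⊥ := by
    rw [Ne, Ideal.span_singleton_eq_bot]; exact_mod_cast hp.ne_zero
  obtain ⟨Q, hQmax, hQ⟩ := Ideal.exists_maximal_ideal_liesOver_of_isIntegral (S := 𝓞 X) (Ideal.span {(p : ℤ)})
  haveI := hQmax
  haveI := hQ
  have hQ0 : Q ≠ ⊥ := Ideal.ne_bot_of_liesOver_of_ne_bot hp0 Q
  set P := Q.under (𝓞 ↥F) with hPdef
  haveI : Q.LiesOver P := ⟨rfl⟩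
  haveI : P.IsPrime := Ideal.IsPrime.under _ Q
  haveI : P.LiesOver (Ideal.span {(p : ℤ)}) := Ideal.LiesOver.tower_bot Q P _
  set 𝔮 := Q.under (𝓞 ↥(maximalRealSubfield X)) with h𝔮def
  haveI : Q.LiesOver 𝔮 := ⟨rfl⟩
  haveI : 𝔮.IsPrime := Ideal.IsPrime.under _ Q
  haveI : 𝔮.LiesOver (Ideal.span {(p : ℤ)}) := Ideal.LiesOver.tower_bot Q 𝔮 _
  have heF : P.ramificationIdx ℤ = p ^ k * (p - 1) := IsCyclotomicExtension.Rat.ramificationIdx_eq_of_prime_pow p k ↥F P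
  have h1 : Q.ramificationIdx ℤ = P.ramificationIdx ℤ * Q.ramificationIdx (𝓞 ↥F) :=
    Ideal.ramificationIdx_tower (R := ℤ) (S := 𝓞 ↥F) (T := 𝓞 X) (q := P) (r := Q)
  have h2 : Q.ramificationIdx ℤ = 𝔮.ramificationIdx ℤ * Q.ramificationIdx (𝓞 ↥(maximalRealSubfield X)) :=
    Ideal.ramificationIdx_tower (R := ℤ) (S := 𝓞 ↥(maximalRealSubfield X)) (T := 𝓞 X) (q := 𝔮) (r := Q)
  have he𝔮 : 𝔮.ramificationIdx ℤ = 1 := by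
    have hunr := (NumberField.not_dvd_discr_iff_isUnramifiedIn ↥(maximalRealSubfield X) (𝓞 ↥(maximalRealSubfield X)) hp').mp (hdisc p hp hp2)
    exact (Algebra.isUnramifiedIn_iff_forall_ramificationIdx_eq_one.mp hunr) 𝔮 inferInstance
  have hle2 := ramificationIdx_maximalRealSubfield_le_two X ⟨Q, hQmax.isPrime, hQ0⟩
  have hpos : 0 < Q.ramificationIdx (𝓞 ↥F) := Ideal.ramificationIdx_pos _ _
  rw [he𝔮, one_mul] at h2
  have : p ^ k * (p - 1) * Q.ramificationIdx (𝓞 ↥F) ≤ 2 := by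
    rw [← heF, ← h1, h2]; exact hle2
  calc p ^ k * (p - 1) ≤ p ^ k * (p - 1) * Q.ramificationIdx (𝓞 ↥F) := Nat.le_mul_of_pos_right _ hpos
    _ ≤ 2 := this

end Ram

/-! ## §4 (W): the roots of unity of `e(K)·ℚ_m` lie in `e(K)` -/

section RootsOfUnity

/-- For a prime `ℓ` dividing a squarefree number, `ℓ²` does not divide it. [folklore] -/
private theorem not_sq_dvd_of_squarefree {d ℓ : ℕ} (hsf : Squarefree d) (hℓ : ℓ.Prime) : ¬ ℓ ^ 2 ∣ d := fun h =>
  hℓ.not_isUnit (hsf ℓ (by rw [← pow_two]; exact h))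

/-- **A REAL algebraic number `t` of a CM field `X` with `t² = N`, `ℓ ∥ N` for an odd prime `ℓ`, contradicts «`X⁺` is unramified at every odd prime»** (the valuation
lemma `dvd_discr_of_sq_eq` in `X⁺`). [cite: NeukirchANT1999, Ch. III §2 Thm. (2.6)] -/
theorem false_of_real_sq_eq (X : Type) [Field X] [NumberField X] [IsCMField X]
    (hdisc : ∀ ℓ : ℕ, ℓ.Prime → ℓ ≠ 2 → ¬ (ℓ : ℤ) ∣ NumberField.discr ↥(maximalRealSubfield X))
    {t : X} (hreal : complexConj X t = t) {N ℓ : ℕ} (ht : t ^ 2 = (N : X)) (hℓ : ℓ.Prime) (hℓ2 : ℓ ≠ 2) (hℓN : ℓ ∣ N)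
    (hℓ2N : ¬ ℓ ^ 2 ∣ N) : False := by
  have hint : IsIntegral ℤ t := by
    refine IsIntegral.of_pow two_pos ?_
    rw [ht]; exact isIntegral_natCast N
  set tI : 𝓞 X := ⟨t, hint⟩ with htI
  have htIval : (tI : X) = t := rfl
  obtain ⟨b, hb⟩ := (IsCMField.RingOfIntegers.complexConj_eq_self_iff X tI).mp (by rw [htIval]; exact hreal)
  have hb2 : b ^ 2 = (N : 𝓞 ↥(maximalRealSubfield X)) := by
    have hinj : Function.Injective (algebraMap (𝓞 ↥(maximalRealSubfield X)) X) := by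
      rw [IsScalarTower.algebraMap_eq (𝓞 ↥(maximalRealSubfield X)) ↥(maximalRealSubfield X) X]
      exact (algebraMap ↥(maximalRealSubfield X) X).injective.comp RingOfIntegers.coe_injective
    apply hinj
    rw [map_pow, hb, htIval, ht, map_natCast]
  exact hdisc ℓ hℓ hℓ2 (dvd_discr_of_sq_eq ↥(maximalRealSubfield X) b hℓ hb2 hℓN hℓ2N)

variable {κ : ZpExtension ℚ 2} (hκ : κ.IsCyclotomic) (K : Type) [Field K] [NumberField K]

include hκ in
/-- ★ **(W): every root of unity of `X_m = e(K)·ℚ_m` lies in `e(K)`**, for `[K : ℚ] = 2`, `K ∋ η` with `η² = −d`, `d ≡ 3 (mod 4)` squarefree.  With `δ = e(η)`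
(`δ̄ = −δ`): a primitive `p`-th (`p ≥ 5`) or `9`-th root of unity is excluded by §3; `i ∈ X_m` would make `iδ ∈ X_m⁺` with square `d` (§1 at an `ℓ ∥ d`); a primitive cube
root `ζ` gives `w = 2ζ + 1`, `w² = −3`: if `d = 3` then `w = ±δ` and `ζ ∈ e(K)`, else `wδ ∈ X_m⁺` has square `3d` (§1 at an odd `ℓ ∥ 3d`).  So `x⁶ = 1`, `x³ = ±1`,
`x² ∈ {1, ζ₃^{±1}} ⊆ e(K)`, `x = x³/x² ∈ e(K)`. [cite: Ferrero1980AJM, §3] [cite: Washington1997, §13.1 and Prop. 13.26] -/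
theorem rootsOfUnity_mem_fieldRange (hK2 : Module.finrank ℚ K = 2) {d : ℕ} (hsf : Squarefree d) (hd4 : d % 4 = 3)
    (hη : ∃ η : K, η ^ 2 = -((d : ℕ) : K)) (m : ℕ) (x : ↥((absEmbedding ℚ K).fieldRange ⊔ κ.layer m))
    (hx : ∃ k : ℕ, 0 < k ∧ x ^ k = 1) : (x : AlgebraicClosure ℚ) ∈ (absEmbedding ℚ K).fieldRange := by
  classical
  obtain ⟨hIQ, -, -⟩ := isImaginaryQuadratic_and_natAbs_discr_eq_of_sq_eq_neg K hK2 hsf hd4 hη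
  haveI : NumberField ↥((absEmbedding ℚ K).fieldRange ⊔ κ.layer m) := numberField_fieldRange_sup_layer κ K (absEmbedding ℚ K) m
  obtain ⟨hCM, -, hrest⟩ := isCMField_fieldRange_sup_layer hκ K hIQ (absEmbedding ℚ K) m
  haveI : IsCMField ↥((absEmbedding ℚ K).fieldRange ⊔ κ.layer m) := hCM
  obtain ⟨-, -, hdisc0, -⟩ := hrest
  have hdisc : ∀ ℓ : ℕ, ℓ.Prime → ℓ ≠ 2 → ¬ (ℓ : ℤ) ∣ NumberField.discr ↥(maximalRealSubfield ↥((absEmbedding ℚ K).fieldRange ⊔ κ.layer m)) := hdisc0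
  obtain ⟨η, hη⟩ := hη
  have hd3 : 3 ≤ d := by omega
  have hd0 : (0 : ℚ) < d := by exact_mod_cast (show 0 < d by omega)
  let eK : K →+* ↥((absEmbedding ℚ K).fieldRange ⊔ κ.layer m) := ((absEmbedding ℚ K) : K →+* AlgebraicClosure ℚ).codRestrict ((absEmbedding ℚ K).fieldRange ⊔ κ.layer m) fun y =>
    (le_sup_left : (absEmbedding ℚ K).fieldRange ≤ (absEmbedding ℚ K).fieldRange ⊔ κ.layer m) ((absEmbedding ℚ K).mem_fieldRange.mpr ⟨y, rfl⟩)
  set δ : ↥((absEmbedding ℚ K).fieldRange ⊔ κ.layer m) := eK η with hδdef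
  have hδmem : ∀ y : K, ((eK y : ↥((absEmbedding ℚ K).fieldRange ⊔ κ.layer m)) : AlgebraicClosure ℚ) ∈ (absEmbedding ℚ K).fieldRange := fun y =>
    (absEmbedding ℚ K).mem_fieldRange.mpr ⟨y, rfl⟩
  have hδ2 : δ ^ 2 = -((d : ℚ) : ↥((absEmbedding ℚ K).fieldRange ⊔ κ.layer m)) := by
    rw [hδdef, ← map_pow, hη, map_neg, map_natCast, Rat.cast_natCast]
  have hδconj : complexConj ↥((absEmbedding ℚ K).fieldRange ⊔ κ.layer m) δ = -δ := complexConj_eq_neg_of_sq_eq_neg ↥((absEmbedding ℚ K).fieldRange ⊔ κ.layer m) hd0 hδ2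
  have hδ0 : δ ≠ 0 := by
    intro h0; rw [h0, zero_pow two_ne_zero] at hδ2
    have h1 : ((d : ℚ) : ↥((absEmbedding ℚ K).fieldRange ⊔ κ.layer m)) = 0 := by linear_combination hδ2
    have h2 : d = 0 := by exact_mod_cast h1
    omega
  -- membership of `e(K)` in terms of `eK`
  have hmemK : ∀ z : ↥((absEmbedding ℚ K).fieldRange ⊔ κ.layer m), (∃ y : K, eK y = z) → (z : AlgebraicClosure ℚ) ∈ (absEmbedding ℚ K).fieldRange := by
    rintro z ⟨y, rfl⟩; exact hδmem y
  -- (I) `i ∉ X`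
  have hI : ∀ y : ↥((absEmbedding ℚ K).fieldRange ⊔ κ.layer m), y ^ 2 = -1 → False := by
    intro y hy
    have hyconj : complexConj ↥((absEmbedding ℚ K).fieldRange ⊔ κ.layer m) y = -y := complexConj_eq_neg_of_sq_eq_neg ↥((absEmbedding ℚ K).fieldRange ⊔ κ.layer m) one_pos (by rw [hy]; norm_num)
    have hreal : complexConj ↥((absEmbedding ℚ K).fieldRange ⊔ κ.layer m) (y * δ) = y * δ := by rw [map_mul, hyconj, hδconj]; ring
    have ht : (y * δ) ^ 2 = (d : ↥((absEmbedding ℚ K).fieldRange ⊔ κ.layer m)) := by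
      rw [mul_pow, hy, hδ2, Rat.cast_natCast]; ring
    obtain ⟨ℓ, hℓ, hℓd⟩ := Nat.exists_prime_and_dvd (show d ≠ 1 by omega)
    have hℓ2 : ℓ ≠ 2 := by rintro rfl; omega
    exact false_of_real_sq_eq _ hdisc hreal ht hℓ hℓ2 hℓd (not_sq_dvd_of_squarefree hsf hℓ)
  -- (C3) primitive cube roots lie in `e(K)`
  have hC3 : ∀ ζ : ↥((absEmbedding ℚ K).fieldRange ⊔ κ.layer m), ζ ^ 2 + ζ + 1 = 0 → (ζ : AlgebraicClosure ℚ) ∈ (absEmbedding ℚ K).fieldRange := by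
    intro ζ hζ
    set w : ↥((absEmbedding ℚ K).fieldRange ⊔ κ.layer m) := 2 * ζ + 1 with hw
    have hw2 : w ^ 2 = -((3 : ℚ) : ↥((absEmbedding ℚ K).fieldRange ⊔ κ.layer m)) := by
      rw [hw]; push_cast; linear_combination 4 * hζ
    have hwconj : complexConj ↥((absEmbedding ℚ K).fieldRange ⊔ κ.layer m) w = -w := complexConj_eq_neg_of_sq_eq_neg ↥((absEmbedding ℚ K).fieldRange ⊔ κ.layer m) (by norm_num) hw2
    by_cases hd3' : d = 3
    · -- `w = ±δ`, so `ζ = (±δ − 1)/2 ∈ e(K)`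
      subst hd3'
      have hprod : (w - δ) * (w + δ) = 0 := by
        have : w ^ 2 = δ ^ 2 := by rw [hw2, hδ2]; norm_num
        linear_combination this
      have h2 : (2 : ↥((absEmbedding ℚ K).fieldRange ⊔ κ.layer m)) ≠ 0 := two_ne_zero
      rcases mul_eq_zero.mp hprod with h | h
      · apply hmemK
        refine ⟨(η - 1) / 2, ?_⟩
        rw [map_div₀, map_sub, map_one, map_ofNat]
        change (δ - 1) / 2 = ζ
        rw [← sub_eq_zero.mp h, hw]; ring
      · apply hmemK
        refine ⟨(-η - 1) / 2, ?_⟩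
        rw [map_div₀, map_sub, map_neg, map_one, map_ofNat]
        change (-δ - 1) / 2 = ζ
        have : δ = -w := by linear_combination h
        rw [this, hw]; ring
    · exfalso
      have hreal : complexConj ↥((absEmbedding ℚ K).fieldRange ⊔ κ.layer m) (w * δ) = w * δ := by rw [map_mul, hwconj, hδconj]; ring
      have ht : (w * δ) ^ 2 = ((3 * d : ℕ) : ↥((absEmbedding ℚ K).fieldRange ⊔ κ.layer m)) := by
        rw [mul_pow, hw2, hδ2]; push_cast; ring
      -- an odd prime `ℓ ∥ 3d`
      obtain ⟨ℓ, hℓ, hℓ2, hℓN, hℓ2N⟩ : ∃ ℓ : ℕ, ℓ.Prime ∧ ℓ ≠ 2 ∧ ℓ ∣ 3 * d ∧ ¬ ℓ ^ 2 ∣ 3 * d := by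
        by_cases h3 : 3 ∣ d
        · obtain ⟨d', rfl⟩ := h3
          have hd'1 : d' ≠ 1 := fun h => hd3' (by rw [h])
          obtain ⟨ℓ, hℓ, hℓd'⟩ := Nat.exists_prime_and_dvd hd'1
          have hℓ3 : ℓ ≠ 3 := by
            rintro rfl
            exact not_sq_dvd_of_squarefree hsf Nat.prime_three (by rw [pow_two]; exact Nat.mul_dvd_mul_left 3 hℓd')
          have hℓ2 : ℓ ≠ 2 := by
            rintro rfl
            have : 2 ∣ 3 * d' := dvd_mul_of_dvd_right hℓd' 3
            omega
          refine ⟨ℓ, hℓ, hℓ2, dvd_mul_of_dvd_right (dvd_mul_of_dvd_right hℓd' 3) 3, fun h => ?_⟩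
          -- `ℓ² ∣ 9 d'` with `ℓ ≠ 3` prime forces `ℓ² ∣ d'`
          have hcop : Nat.Coprime (ℓ ^ 2) 9 := by
            rw [show (9 : ℕ) = 3 ^ 2 by norm_num]
            exact Nat.Coprime.pow 2 2 ((Nat.coprime_primes hℓ Nat.prime_three).mpr hℓ3)
          have h' : ℓ ^ 2 ∣ 9 * d' := by rw [show 9 * d' = 3 * (3 * d') by ring]; exact h
          have := hcop.dvd_of_dvd_mul_left h'
          exact not_sq_dvd_of_squarefree (Squarefree.squarefree_of_dvd (dvd_mul_left d' 3) hsf) hℓ this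
        · refine ⟨3, Nat.prime_three, by norm_num, dvd_mul_right 3 d, fun h => h3 ?_⟩
          rw [pow_two] at h
          exact Nat.dvd_of_mul_dvd_mul_left (by norm_num) h
      exact false_of_real_sq_eq _ hdisc hreal ht hℓ hℓ2 hℓN hℓ2N
  -- the order of `x` divides `6`
  obtain ⟨k, hk, hxk⟩ := hx
  set n := orderOf x with hn
  have hn0 : 0 < n := by
    rw [hn, orderOf_pos_iff]; exact isOfFinOrder_iff_pow_eq_one.mpr ⟨k, hk, hxk⟩
  have hprim : IsPrimitiveRoot x n := IsPrimitiveRoot.orderOf x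
  have hn6 : n ∣ 6 := by
    refine (Nat.dvd_iff_prime_pow_dvd_dvd 6 n).mpr ?_
    intro p j hp hpj
    rcases j with _ | j
    · rw [pow_zero]; exact one_dvd _
    rcases Nat.lt_or_ge 3 p with hp3 | hp3
    · -- `p ≥ 5`: a primitive `p`-th root of unity, excluded
      exfalso
      have hpn : p ∣ n := (dvd_pow_self p (Nat.succ_ne_zero j)).trans hpj
      obtain ⟨c, hc⟩ := hpn
      have hζ : IsPrimitiveRoot (x ^ c) (p ^ (0 + 1)) := by
        rw [zero_add, pow_one]; exact hprim.pow hn0 (by rw [hc, mul_comm])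
      have hp2 : p ≠ 2 := by omega
      have := totient_le_two_of_isPrimitiveRoot _ hdisc hp hp2 hζ
      rw [pow_zero, one_mul] at this; omega
    · -- `p ∈ {2, 3}` and `p² ∤ n`
      have hp23 : p = 2 ∨ p = 3 := by
        have := hp.two_le; omega
      have hj : j = 0 := by
        by_contra hj0
        have hp2n : p ^ 2 ∣ n := (pow_dvd_pow p (show 2 ≤ j + 1 by omega)).trans hpj
        obtain ⟨c, hc⟩ := hp2n
        rcases hp23 with rfl | rfl
        · -- a primitive 4th root: its square is `−1`
          have hζ : IsPrimitiveRoot (x ^ c) 4 := hprim.pow hn0 (by rw [hc]; ring)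
          have h4 : (x ^ c) ^ 4 = 1 := hζ.pow_eq_one
          have h2 : (x ^ c) ^ 2 ≠ 1 := fun h => by
            have := hζ.dvd_of_pow_eq_one 2 h; omega
          have hsq : ((x ^ c) ^ 2) ^ 2 = 1 := by rw [← pow_mul]; exact h4
          rcases sq_eq_one_iff.mp hsq with h | h
          · exact h2 h
          · exact hI _ h
        · -- a primitive 9th root, excluded
          have hζ : IsPrimitiveRoot (x ^ c) (3 ^ (1 + 1)) := hprim.pow hn0 (by rw [hc]; ring)
          have := totient_le_two_of_isPrimitiveRoot _ hdisc Nat.prime_three (by norm_num) hζ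
          norm_num at this
      subst hj
      rcases hp23 with rfl | rfl <;> norm_num
  -- `x⁶ = 1`: `x³ = ±1`, `x²` is `1` or a primitive cube root, `x = x³ / x²`
  have hx6 : x ^ 6 = 1 := by
    obtain ⟨c, hc⟩ := hn6
    rw [hc, pow_mul, hn, pow_orderOf_eq_one, one_pow]
  have hx0 : x ≠ 0 := fun h => by rw [h, zero_pow (by norm_num)] at hx6; exact zero_ne_one hx6
  have h3 : x ^ 3 = 1 ∨ x ^ 3 = -1 := by
    have : (x ^ 3) ^ 2 = 1 := by rw [← pow_mul]; exact hx6
    exact sq_eq_one_iff.mp this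
  have h2mem : ((x ^ 2 : ↥((absEmbedding ℚ K).fieldRange ⊔ κ.layer m)) : AlgebraicClosure ℚ) ∈ (absEmbedding ℚ K).fieldRange := by
    have hcube : (x ^ 2) ^ 3 = 1 := by rw [← pow_mul]; exact hx6
    have hfac : (x ^ 2 - 1) * ((x ^ 2) ^ 2 + x ^ 2 + 1) = 0 := by linear_combination hcube
    rcases mul_eq_zero.mp hfac with h | h
    · rw [sub_eq_zero.mp h]; push_cast; exact one_mem _
    · exact hC3 _ h
  have h3mem : ((x ^ 3 : ↥((absEmbedding ℚ K).fieldRange ⊔ κ.layer m)) : AlgebraicClosure ℚ) ∈ (absEmbedding ℚ K).fieldRange := by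
    rcases h3 with h | h
    · rw [h]; push_cast; exact one_mem _
    · rw [h]; simp
  have hxeq : x = x ^ 3 / x ^ 2 := by field_simp
  rw [hxeq]
  push_cast
  exact div_mem h3mem h2mem

end RootsOfUnity

/-! ## §5 Ferrero–Kida for `d ≡ 3 (mod 4)`, unconditionally -/

section Final

variable (K : Type) [Field K] [NumberField K]

/-- ★★ **Ferrero 1980 / Kida 1979 for `ℚ(√−d)`, `d ≡ 3 (mod 4)` squarefree — PROVED.**  `[K : ℚ] = 2`, `K ∋ η` with `η² = −d`; then for EVERY cyclotomic
`ℤ₂`-extension `κ` of `K`: **`μ = 0` (growth form) and `classicalLambda κ + 1 = Σ_{p ∈ primeFactors d ∖ {2}} 2^{v₂(p²−1)−3}`** — the conclusion of the named fact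
`ferreroKida_classicalLambda_two_imaginaryQuadratic`, on the half `d ≡ 3 (mod 4)` of its hypothesis `d > 2` squarefree.  Upper half: genus theory in the tower + a
Fukuda rank certificate (g30); lower half: no capitulation (explicit Hilbert 90, (W) = `rootsOfUnity_mem_fieldRange`) + `λ =` eventual `2`-rank.
[cite: Ferrero1980AJM, Thm.] [cite: Kida1979Tohoku, Thm. 1] [cite: Schettler2014, Thm. 2] -/
theorem ferreroKida_of_sq_eq_neg (hK2 : Module.finrank ℚ K = 2) {d : ℕ} (hsf : Squarefree d) (hd4 : d % 4 = 3)
    (hη : ∃ η : K, η ^ 2 = -((d : ℕ) : K)) (κ : ZpExtension K 2) (hκ : κ.IsCyclotomic) :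
    ClassicalMuVanishes κ ∧ classicalLambda κ + 1 = ∑ p ∈ d.primeFactors.erase 2, 2 ^ (padicValNat 2 (p ^ 2 - 1) - 3) :=
  ferreroKida_of_sq_eq_neg_of_rootsOfUnity K hK2 hsf hd4 hη
    (fun m x hx => rootsOfUnity_mem_fieldRange (CyclotomicZp.isCyclotomic_zpExtension 2) K hK2 hsf hd4 hη m x hx) κ hκ

end Final

end Literature.NumberTheory.IwasawaTheory

end
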